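import Summits.MatrixMultiplication.MatrixMultiplication.Theorems.AbelianSTPPSieveVP

/-!
# Rule U11-F2 of the abelian STPP census: the index-2 fibred Pollard condition `FP2Adm` and its kernel checker

Cell mm-stpp (rung F-M1), PRE-REG v1 band B3 «past the walls» (seat mm-stpp-theory, gen 13): a NEW necessary condition on the shape
list of an STPP family in a finite abelian group, beyond the registered trio `SieveAdmissible` (vM) ∧ `U11G` (Grynkiewicz) ∧
`TAKnap575.E3Adm` (three-room energy).  It bites at the orders `M = 2p`, `p` prime — where `H ≅ ℤ/2 × ℤ/p` has the subgroup `P` of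
prime order `p` and index `2`, and Pollard's theorem holds INSIDE each of the two cosets of `P` although `M` itself is composite
(rule U11-P is silent there, and U11-G loses `2t²` where Pollard loses `t²`).

THE RULE (form B; forms A, C are the rule for the rotated families `(C,A,B)`, `(B,C,A)`).  Notation of `AbelianSTPPSieveVP` /
`AbelianSTPPCensusVPBookkeeping`: `X = ⋃ (B_j − A_j)` (`|X| = P_AB`), `Y = ⋃ (C_k − B_k)` (`|Y| = P_BC`), `Z′ = ⋃ (C_i − A_i)`
(`|Z′| = P_CA`), `r_{X,Y}(c − a) = b_i` on `C_i − A_i`.  Let `x, y, z` be the numbers of elements of `X, Y, Z′` lying in `P`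
(so `P_AB − x` etc. lie in the other coset `P′`).  Sums of two elements of the same coset lie in `P`, mixed sums in `P′`.  For the
coset `P` (target count `W = z`, pairs `(X∩P, Y∩P)` and `(X∖P, Y∖P)`) and any `s₀ ≤ min(x, y)`, `s₁ ≤ min(P_AB − x, P_BC − y)`,
Pollard's theorem in `P ≅ ℤ/p` for each pair and the ceiling `Σ_{w ∈ P} min(T, r_{X,Y}(w)) ≤ W·min(T, b_max) + T·(p − W)`
(`T = s₀ + s₁`) give
  `s₀·min(p, x + y − s₀) + s₁·min(p, (P_AB − x) + (P_BC − y) − s₁) ≤ W·min(s₀ + s₁, b_max) + (s₀ + s₁)·(p − W)`   (`CosetIneq`),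
and the same for the coset `P′` (target count `P_CA − z`, pairs `(X∩P, Y∖P)`, `(X∖P, Y∩P)`); moreover `W ≤` the number of pairs
landing in the coset (every element of `Z′` is a sum `x + y`) and both target counts are `≤ p` (`FormOK`).  `FP2Adm M a b c` says: IF
`M = 2p` with `p` prime THEN some `(x, y, z)` passes all three letter forms.  Soundness (`IsSTPP ⇒ FP2Adm`) is
`AbelianSTPPCensusFP2Sound.lean`; this file has the definitions and the Boolean checker `FP2.check` (parameter menu `s = min(m, e⁺ + k)`,
`k ∈ {0, 16}`, `m` = the smaller class, `e⁺ = (σ − p)⁺` the free saturation; thresholds in the target count for form B, then the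
three forms at each surviving `z`), whose soundness and the first kill (T_E wall list `(6,6,8)⁴ + (4,5,3)` at `478 = 2·239`,
`AbelianSTPPCensusVQKWitness478`) are `AbelianSTPPCensusFP2Check.lean` / `AbelianSTPPCensusFP2Wall478.lean`.
Exact Python twin: seat folder `calc/lean_mirror.py` (menu `[0,16]`: `check = true` at 478, 180 `z`-candidates); design numerics kit
j316300 / j316345 / j316348 / j316350; sanity `calc/validate_fp2.py` (608 random STPP families in `ℤ/2p`, `p ≤ 13`: no violation).
WHAT THIS IS NOT: no claim here (definitions only); no `ω` statement; the rule is silent at every order not of the form `2p`.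
-/

set_option linter.dupNamespace false -- `MatrixMultiplication.MatrixMultiplication` (summit = problem, D-0017)
set_option autoImplicit false

namespace Summit.MatrixMultiplication.MatrixMultiplication.Theorems

open Finset

namespace FP2

/-! ### The shape-level predicate -/

/-- Pollard's floor for one pair of coset classes of sizes `f`, `g` at parameter `s`: `s · min(p, f + g − s)`
(checker vocabulary, no claim). [bookkeeping] -/
def pairFloor (p f g s : ℕ) : ℕ := s * min p (f + g - s)

/-- The fibred inequality for ONE coset of the index-2 subgroup (size `p`): the two pairs of classes `(f₀, g₀)`, `(f₁, g₁)` whose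
sums land in this coset, `W` = number of target elements (`r`-value `≤ v`) in the coset; for all admissible parameters
`s₀ ≤ min(f₀,g₀)`, `s₁ ≤ min(f₁,g₁)`: `pairFloor f₀ g₀ s₀ + pairFloor f₁ g₁ s₁ ≤ W·min(s₀+s₁, v) + (s₀+s₁)·(p − W)`
(shape-level predicate, no claim). [original] -/
def CosetIneq (p f₀ g₀ f₁ g₁ W v : ℕ) : Prop :=
  ∀ s₀ s₁ : ℕ, s₀ ≤ f₀ → s₀ ≤ g₀ → s₁ ≤ f₁ → s₁ ≤ g₁ →
    pairFloor p f₀ g₀ s₀ + pairFloor p f₁ g₁ s₁ ≤ W * min (s₀ + s₁) v + (s₀ + s₁) * (p - W)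

/-- One letter form of the rule: first difference union of total size `F` with `f` elements in `P`, second of size `S` with `s` in `P`,
target union of size `Wt` with `w` in `P` and `r`-values `≤ v`: class bounds, the coset-`P` inequality (pairs `(P,P)`, `(P′,P′)`),
the coset-`P′` inequality (pairs `(P,P′)`, `(P′,P)`), and the two mass bounds (each target element is a pair sum)
(shape-level predicate, no claim). [original] -/
def FormOK (p F S Wt v f s w : ℕ) : Prop :=
  f ≤ F ∧ s ≤ S ∧ w ≤ Wt ∧ w ≤ p ∧ Wt - w ≤ p ∧
  CosetIneq p f s (F - f) (S - s) w v ∧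
  CosetIneq p f (S - s) (F - f) s (Wt - w) v ∧
  w ≤ f * s + (F - f) * (S - s) ∧ Wt - w ≤ f * (S - s) + (F - f) * s

variable {N : ℕ}

/-- **Rule U11-F2 (index-2 fibred Pollard), shape form.**  At an order `M = 2p` with `p` prime there are coset counts
`x ≤ P_AB`, `y ≤ P_BC`, `z ≤ P_CA` of `X = ⋃(B − A)`, `Y = ⋃(C − B)`, `Z′ = ⋃(C − A)` in the index-2 subgroup passing form B
(`X, Y → Z′`, values `b`), form A (`−Z′, X → −Y`, values `a`; the rule for the rotated family `(C, A, B)`) and form C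
(`Y, −Z′ → −X`, values `c`; rotated family `(B, C, A)`).  Vacuous unless `M = 2p`.  The shape data of every `IsSTPP` family with non-empty
sets in a finite abelian group of order `M` satisfies it (`FP2.fp2Adm_of_isSTPP`, file `AbelianSTPPCensusFP2Sound`).  No claim by itself. [original] -/
def FP2Adm (M : ℕ) (a b c : Fin N → ℕ) : Prop :=
  ∀ p : ℕ, M = 2 * p → p.Prime →
    ∃ x y z : ℕ,
      FormOK p (pAB a b c) (pBC a b c) (pCA a b c) (univ.sup b) x y z ∧
      FormOK p (pCA a b c) (pAB a b c) (pBC a b c) (univ.sup a) z x y ∧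
      FormOK p (pBC a b c) (pCA a b c) (pAB a b c) (univ.sup c) y z x

/-! ### The kernel checker (Boolean; soundness in `AbelianSTPPCensusFP2Check.lean`) -/

/-- The parameter menu: extra amount `k` above the free saturation (checker-internal). [bookkeeping] -/
def menu : List ℕ := [0, 16]

/-- The parameter tried for a pair `(f, g)`: `min(min(f, g), (f + g − p) + k)` (admissible: `≤ f`, `≤ g`; checker-internal). [bookkeeping] -/
def param (p f g k : ℕ) : ℕ := min (min f g) (f + g - p + k)

/-- The ceiling of a coset with `W` target elements of value `≤ v` at total parameter `T`: `W·min(T, v) + T·(p − W)` (checker-internal). [bookkeeping] -/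
def ceil (p W v T : ℕ) : ℕ := W * min T v + T * (p - W)

/-- Is the coset inequality violated at the parameters `(s₀, s₁)`? (checker-internal) [bookkeeping] -/
def violAt (p f₀ g₀ f₁ g₁ W v s₀ s₁ : ℕ) : Bool :=
  decide (ceil p W v (s₀ + s₁) < pairFloor p f₀ g₀ s₀ + pairFloor p f₁ g₁ s₁)

/-- Is the coset inequality violated at some menu parameters? (checker-internal) [bookkeeping] -/
def cosetKilled (p f₀ g₀ f₁ g₁ W v : ℕ) : Bool :=
  menu.any fun k₀ => menu.any fun k₁ => violAt p f₀ g₀ f₁ g₁ W v (param p f₀ g₀ k₀) (param p f₁ g₁ k₁)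

/-- Threshold at parameters `(s₀, s₁)` with `T = s₀ + s₁ > v`: every target count `W` with `thrAt ≤ W ≤ p` violates the coset
inequality (`W·(T − v) > T·p − floor`); `p + 1` (never reached) when `T ≤ v` (checker-internal). [bookkeeping] -/
def thrAt (p f₀ g₀ f₁ g₁ v s₀ s₁ : ℕ) : ℕ :=
  if v < s₀ + s₁ then ((s₀ + s₁) * p - (pairFloor p f₀ g₀ s₀ + pairFloor p f₁ g₁ s₁)) / (s₀ + s₁ - v) + 1 else p + 1

/-- The least menu threshold for a coset (target counts `≥ thr` and `≤ p` are killed; checker-internal). [bookkeeping] -/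
def thr (p f₀ g₀ f₁ g₁ v : ℕ) : ℕ :=
  (menu.flatMap fun k₀ => menu.map fun k₁ => thrAt p f₀ g₀ f₁ g₁ v (param p f₀ g₀ k₀) (param p f₁ g₁ k₁)).foldr min (p + 1)

/-- Is the letter form `FormOK p F S Wt v f s w` refuted by a bound, a menu violation in one of the two cosets, or a mass bound? (checker-internal) [bookkeeping] -/
def formKilled (p F S Wt v f s w : ℕ) : Bool :=
  decide (F < f) || decide (S < s) || decide (Wt < w) || decide (p < w) || decide (p < Wt - w) ||
    cosetKilled p f s (F - f) (S - s) w v || cosetKilled p f (S - s) (F - f) s (Wt - w) v ||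
    decide (f * s + (F - f) * (S - s) < w) || decide (f * (S - s) + (F - f) * s < Wt - w)

/-- Is the triple of coset counts `(x, y, z)` refuted by form B, form A or form C?  (`X, Y, Z` = `P_AB, P_BC, P_CA`;
`va, vb, vc` = the largest `a`, `b`, `c`; checker-internal.) [bookkeeping] -/
def tripleKilled (p X Y Z va vb vc x y z : ℕ) : Bool :=
  formKilled p X Y Z vb x y z || formKilled p Z X Y va z x y || formKilled p Y Z X vc y z x

/-- Cell check at `(x, y)`: the form-B thresholds confine a surviving `z` to `[Z − (t₁ − 1), min(t₀ − 1, Z)]`; every `z` of that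
interval must be refuted by `tripleKilled` (checker-internal). [bookkeeping] -/
def cellOK (p X Y Z va vb vc x y : ℕ) : Bool :=
  let t₀ := thr p x y (X - x) (Y - y) vb
  let t₁ := thr p x (Y - y) (X - x) y vb
  let lo := Z - (t₁ - 1)
  let hi := min (t₀ - 1) Z
  (List.range' lo (hi + 1 - lo)).all fun z => tripleKilled p X Y Z va vb vc x y z

/-- The checker on the `x`-range `lo ≤ x < lo + n` (all `y ≤ Y`): `true` means every `(x, y, z)` with `x` in the range is refuted
(`FP2.check_sound`, file `AbelianSTPPCensusFP2Check`). [bookkeeping] -/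
def check (p X Y Z va vb vc lo n : ℕ) : Bool :=
  (List.range' lo n).all fun x => (List.range (Y + 1)).all fun y => cellOK p X Y Z va vb vc x y

/-! ### Sanity (kernel evaluation on toy data) -/

/-- The order-`14` TPP triple `A = {0,1}`, `B = {0,2}`, `C = {0,4}` of `ℤ/14` has coset counts `(x,y,z) = (2,4,2)`
(`X = {0,1,2,13}`, `Y = {0,2,4,12}`, `Z′ = {0,3,4,13}`, `P` = even residues) and is not refuted. [bookkeeping] -/
example : tripleKilled 7 4 4 4 2 2 2 2 4 2 = false := by decide

/-- A toy over-packed profile is refuted (everything in `P` at `p = 7` with `|X| = |Y| = |Z′| = 6`). [bookkeeping] -/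
example : tripleKilled 7 6 6 6 2 2 2 6 6 6 = true := by decide

end FP2

end Summit.MatrixMultiplication.MatrixMultiplication.Theorems
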